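import Mathlib.LinearAlgebra.Semisimple
import Mathlib.LinearAlgebra.Matrix.Charpoly.Basic
import Mathlib.Algebra.BigOperators.Finprod
import Literature.LinearAlgebra.Matrix.SimilarityDescent
import Literature.NumberTheory.Automorphic.AdelicUnitaryGroup
import HarnessLib

/-!
# Stable conjugacy in `U(H)(F) ⊂ GL_n(L)`, the correspondence `γ′ ↔ γ` between two unitary groups in the same `GL_n(L)`,
# and the `κ`-orbital sums (Rogawski 1990, §3.1–3.2, §4.1, §14.1)

Namespace `Literature.NumberTheory.Rogawski1990`.  REAL DEFINITIONS over the tree's `unitaryGroup σ H ≤ GL n R` (for a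
CM field `L`, `σ = cmConjRingHom L`: `U(H)(L⁺) = (UnitaryGroup.cmDatum L N H).Rational`) + proved lemmas; no named
fact, no `sorry`, no instance, no notation.  Source [Rogawski1990], printed pages.
* §1 [§3.1 p. 19] «`δ ∈ G` is said to be stably-conjugate to `γ` if there exists `g ∈ G(F̄)` such that `δ = g⁻¹γg`.»
  For `G = U(H)` (`G_der = SU(H)` simply connected) `G(F̄) = GL_n(F̄) ⊃ GL_n(L) ⊃ U(H)(F)`, so stably conjugate =
  `GL_n(F̄)`-conjugate = `GL_n(L)`-conjugate (descent, ★ `Literature.LinearAlgebra.Matrix.isConj_of_isConj_map`):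
  `IsStablyConj σ H γ δ := IsConj (γ : GL n R) δ`; `StableClass`, `charpoly`, `IsSemisimpleElt`; §4–§5: `= GL_n(K)`-
  conjugacy for every field `K ⊇ L` (`isStablyConj_iff_isConj_map`; §5 is the v2 append discharging v1's hypothesis).
* §2 [§3.2 p. 19–20, §14.1 p. 232] «We obtain an injective map from stable semisimple classes in `G′` to … stable
  semisimple classes in `G`.  We write `γ′ ↔ γ` if `𝒪_st(γ′)` corresponds to `𝒪_st(γ)` … `γ` occurs in `G′` if `γ′ ↔ γ`
  for some `γ′ ∈ G′`.»  Two hermitian `H′, H` give unitary groups in the SAME `GL_n(L)`, both `= GL_n` over `F̄` with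
  `ψ = id` an inner twisting, so `γ′ ↔ γ` iff `GL_n(L)`-conjugate: `Corresponds σ H′ H γ′ γ`; on classes
  `StableClass.Corresponds` — functional (`eq_of_corresponds_right`), injective (`eq_of_corresponds_left`), total
  between congruent forms (`corresponds_unitaryGroupCongr`); `StableClass.OccursIn`.  NOT typed: existence for the
  quasi-split `G` (Kottwitz–Steinberg, Thm. 3.2.1) — sub-line T1-orb.
* §3 [§4.1 (4.1.1) p. 39–40] «`Φ^κ(γ, f) = Σ_{γ′} κ(inv(γ, γ′)) Φ(γ′, f)` … within `𝒪_st(γ)` … stable orbital integral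
  `Φ^st(γ, f)`»: LETTERS `kappaOrbitalSum`, `stableOrbitalSum` = `finsum` over `conjClassesIn γ` of an INPUT class
  function `Φ` times a weight; no measure (`inv(γ, γ′) ∈ 𝔇` lives in `GaloisCohomology/NonAbelianH1{,StableClasses}`).
-/

noncomputable section

namespace Literature.NumberTheory.Rogawski1990

open scoped MatrixGroups
open Literature.AlgebraicGeometry.ShimuraVarieties (unitaryGroup mem_unitaryGroup_iff)
open Literature.NumberTheory.Automorphic (unitaryGroupCongr coe_unitaryGroupCongr)

section General

variable {R : Type*} [CommRing R] {n : Type*} [Fintype n] [DecidableEq n] (σ : R →+* R) (H H' : Matrix n n R)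

/-! ## §1 Stable conjugacy in `U(H)(F) ⊂ GL_n(L)` [Rogawski1990, §3.1] -/

/-- **Stable conjugacy** in the unitary group `U_σ(H)(R) ≤ GL_n(R)`: `γ, δ` are stably conjugate iff they are
conjugate in the ambient `GL_n(R)` — for `R = L` a CM field this is Rogawski's «`δ = g⁻¹γg` for some `g ∈ G(F̄) =
GL_n(F̄)`» (§4). [cite: Rogawski1990, §3.1 p. 19] -/
def IsStablyConj (γ δ : unitaryGroup σ H) : Prop :=
  IsConj (γ : GL n R) (δ : GL n R)

variable {σ H H'}

/-- `γ ∼_st δ ↔ ∃ g ∈ GL_n(R), g γ g⁻¹ = δ`. [cite: Rogawski1990, §3.1 p. 19] -/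
theorem isStablyConj_iff {γ δ : unitaryGroup σ H} :
    IsStablyConj σ H γ δ ↔ ∃ g : GL n R, g * (γ : GL n R) * g⁻¹ = δ :=
  isConj_iff

/-- Stable conjugacy is reflexive. [cite: Rogawski1990, §3.1 p. 19] -/
theorem IsStablyConj.refl (γ : unitaryGroup σ H) : IsStablyConj σ H γ γ := IsConj.refl _

/-- Stable conjugacy is symmetric. [cite: Rogawski1990, §3.1 p. 19] -/
theorem IsStablyConj.symm {γ δ : unitaryGroup σ H} (h : IsStablyConj σ H γ δ) : IsStablyConj σ H δ γ :=
  IsConj.symm h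

/-- Stable conjugacy is transitive. [cite: Rogawski1990, §3.1 p. 19] -/
theorem IsStablyConj.trans {γ δ ε : unitaryGroup σ H} (h : IsStablyConj σ H γ δ) (h' : IsStablyConj σ H δ ε) :
    IsStablyConj σ H γ ε :=
  IsConj.trans h h'

/-- Conjugate elements of `U(H)(F)` are stably conjugate (a stable class is a union of conjugacy classes).
[cite: Rogawski1990, §3.1 p. 19] -/
theorem isStablyConj_of_isConj {γ δ : unitaryGroup σ H} (h : IsConj γ δ) : IsStablyConj σ H γ δ :=
  (unitaryGroup σ H).subtype.map_isConj h

/-- Stably conjugate elements have the same characteristic polynomial. [cite: Rogawski1990, §3.1 p. 19] -/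
theorem IsStablyConj.charpoly_eq {γ δ : unitaryGroup σ H} (h : IsStablyConj σ H γ δ) :
    ((γ : GL n R) : Matrix n n R).charpoly = ((δ : GL n R) : Matrix n n R).charpoly := by
  obtain ⟨c, hc⟩ := isConj_iff.mp h
  rw [← hc, Units.val_mul, Units.val_mul, Matrix.coe_units_inv, Matrix.charpoly_units_conj]

variable (σ H) in
/-- The setoid of stable conjugacy on `U(H)(F)`. [cite: Rogawski1990, §3.1 p. 19] -/
def stableConjSetoid : Setoid (unitaryGroup σ H) where
  r := IsStablyConj σ H
  iseqv := ⟨IsStablyConj.refl, IsStablyConj.symm, IsStablyConj.trans⟩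

variable (σ H) in
/-- **The stable conjugacy classes `𝒪_st` of `U(H)(F)`** (all of them; Rogawski's `𝒪_st(G)` is the subset of
semisimple ones, `IsSemisimpleElt`). [cite: Rogawski1990, §3.1 p. 19] -/
def StableClass : Type _ := Quotient (stableConjSetoid σ H)

variable (σ H) in
/-- The stable class `𝒪_st(γ)` of `γ`. [cite: Rogawski1990, §3.1 p. 19] -/
def stableClassOf (γ : unitaryGroup σ H) : StableClass σ H := Quotient.mk (stableConjSetoid σ H) γ

/-- `𝒪_st(γ) = 𝒪_st(δ) ↔ γ ∼_st δ`. [cite: Rogawski1990, §3.1 p. 19] -/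
theorem stableClassOf_eq_iff {γ δ : unitaryGroup σ H} :
    stableClassOf σ H γ = stableClassOf σ H δ ↔ IsStablyConj σ H γ δ :=
  Quotient.eq (r := stableConjSetoid σ H)

/-- Every stable class is `𝒪_st(γ)` for some `γ`. [cite: Rogawski1990, §3.1 p. 19] -/
theorem stableClassOf_surjective : Function.Surjective (stableClassOf σ H) :=
  Quotient.mk_surjective

/-- A stable class is a union of conjugacy classes: the surjection `ConjClasses U(H)(F) → StableClass`.
[cite: Rogawski1990, §3.1 p. 19] -/
def StableClass.ofConjClass : ConjClasses (unitaryGroup σ H) → StableClass σ H :=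
  Quotient.lift (s := IsConj.setoid _) (stableClassOf σ H) fun _ _ h => stableClassOf_eq_iff.mpr (isStablyConj_of_isConj h)

/-- `ofConjClass [γ] = 𝒪_st(γ)`. [cite: Rogawski1990, §3.1 p. 19] -/
@[simp] theorem StableClass.ofConjClass_mk (γ : unitaryGroup σ H) :
    StableClass.ofConjClass (ConjClasses.mk γ) = stableClassOf σ H γ := rfl

/-- The characteristic polynomial of a stable class (well defined by `IsStablyConj.charpoly_eq`). [cite: Rogawski1990, §3.1 p. 19] -/
def StableClass.charpoly : StableClass σ H → Polynomial R :=
  Quotient.lift (fun γ : unitaryGroup σ H => ((γ : GL n R) : Matrix n n R).charpoly) fun _ _ h => h.charpoly_eq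

/-- `charpoly 𝒪_st(γ) = charpoly γ`. [cite: Rogawski1990, §3.1 p. 19] -/
@[simp] theorem StableClass.charpoly_stableClassOf (γ : unitaryGroup σ H) :
    (stableClassOf σ H γ).charpoly = ((γ : GL n R) : Matrix n n R).charpoly := rfl

variable (σ H) in
/-- `γ ∈ U(H)(F)` is **semisimple**: the endomorphism `v ↦ γ v` of `Rⁿ` is semisimple (Mathlib
`Module.End.IsSemisimple`; over a perfect field = diagonalisable over `F̄`). [cite: Rogawski1990, §3.1 p. 19] -/
def IsSemisimpleElt (γ : unitaryGroup σ H) : Prop :=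
  Module.End.IsSemisimple (Matrix.toLin' ((γ : GL n R) : Matrix n n R))

/-- Conjugate matrices give conjugate endomorphisms: semisimplicity of `γ ∈ GL_n` is invariant under conjugacy (so «semisimple» is a
property of the (stable) class, as in «stable conjugacy classes of semisimple elements»). [cite: Rogawski1990, §3.1 p. 19] -/
theorem isSemisimple_toLin'_iff_of_isConj {g h : GL n R} (hc : IsConj g h) :
    Module.End.IsSemisimple (Matrix.toLin' (g : Matrix n n R)) ↔
      Module.End.IsSemisimple (Matrix.toLin' (h : Matrix n n R)) := by
  obtain ⟨c, hc⟩ := isConj_iff.mp hc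
  have hGL : c * g = h * c := by rw [← hc, inv_mul_cancel_right]
  have hmat : (c : Matrix n n R) * (g : Matrix n n R) = (h : Matrix n n R) * (c : Matrix n n R) := by
    rw [← Units.val_mul, hGL, Units.val_mul]
  refine LinearEquiv.isSemisimple_iff (Matrix.toLin' (g : Matrix n n R)) (Matrix.toLin' (h : Matrix n n R))
    (Matrix.toLin'OfInv c.inv_mul c.mul_inv) ?_
  apply LinearMap.ext
  intro v
  change Matrix.toLin' (c : Matrix n n R) (Matrix.toLin' (g : Matrix n n R) v) =
    Matrix.toLin' (h : Matrix n n R) (Matrix.toLin' (c : Matrix n n R) v)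
  rw [← Matrix.toLin'_mul_apply, ← Matrix.toLin'_mul_apply, hmat]

/-- Semisimplicity depends only on the stable class. [cite: Rogawski1990, §3.1 p. 19] -/
theorem IsStablyConj.isSemisimpleElt_iff {γ δ : unitaryGroup σ H} (h : IsStablyConj σ H γ δ) :
    IsSemisimpleElt σ H γ ↔ IsSemisimpleElt σ H δ :=
  isSemisimple_toLin'_iff_of_isConj h

/-- A stable class is **semisimple** if its elements are (well defined). [cite: Rogawski1990, §3.1 p. 19] -/
def StableClass.IsSemisimple : StableClass σ H → Prop :=
  Quotient.lift (IsSemisimpleElt σ H) fun _ _ h => propext h.isSemisimpleElt_iff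

/-- `𝒪_st(γ)` is semisimple iff `γ` is. [cite: Rogawski1990, §3.1 p. 19] -/
@[simp] theorem StableClass.isSemisimple_stableClassOf (γ : unitaryGroup σ H) :
    (stableClassOf σ H γ).IsSemisimple ↔ IsSemisimpleElt σ H γ := Iff.rfl

/-! ## §2 The correspondence `γ′ ↔ γ` between `U(H′)(F)` and `U(H)(F)` [Rogawski1990, §3.2, §14.1] -/

variable (σ) in
/-- **`γ′ ↔ γ`**: `γ′ ∈ U(H′)(F)` and `γ ∈ U(H)(F)` CORRESPOND if they are conjugate in the common ambient `GL_n(R)`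
(for the inner twisting `ψ = id_{GL_n}` between the two unitary groups: «the conjugacy class of `ψ(γ′)` … intersects
`G` in a stable conjugacy class `𝒪_st(γ)`»). [cite: Rogawski1990, §14.1 p. 232] -/
def Corresponds (H₁ H₂ : Matrix n n R) (γ₁ : unitaryGroup σ H₁) (γ₂ : unitaryGroup σ H₂) : Prop :=
  IsConj (γ₁ : GL n R) (γ₂ : GL n R)

/-- For `H′ = H` the correspondence is stable conjugacy. [cite: Rogawski1990, §3.2 p. 19] -/
theorem corresponds_self_iff {γ δ : unitaryGroup σ H} : Corresponds σ H H γ δ ↔ IsStablyConj σ H γ δ := Iff.rfl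

/-- `↔` is symmetric in the two groups. [cite: Rogawski1990, §14.1 p. 232] -/
theorem corresponds_comm {γ' : unitaryGroup σ H'} {γ : unitaryGroup σ H} :
    Corresponds σ H' H γ' γ ↔ Corresponds σ H H' γ γ' :=
  isConj_comm

/-- `↔` only depends on the stable class of `γ′`. [cite: Rogawski1990, §14.1 p. 232] -/
theorem Corresponds.of_isStablyConj_left {γ' δ' : unitaryGroup σ H'} {γ : unitaryGroup σ H}
    (h : Corresponds σ H' H γ' γ) (h' : IsStablyConj σ H' γ' δ') : Corresponds σ H' H δ' γ :=
  IsConj.trans h'.symm h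

/-- `↔` only depends on the stable class of `γ`. [cite: Rogawski1990, §14.1 p. 232] -/
theorem Corresponds.of_isStablyConj_right {γ' : unitaryGroup σ H'} {γ δ : unitaryGroup σ H}
    (h : Corresponds σ H' H γ' γ) (h' : IsStablyConj σ H γ δ) : Corresponds σ H' H γ' δ :=
  IsConj.trans h h'

/-- **The correspondence is a map on stable classes** (functional): `γ′ ↔ γ₁` and `γ′ ↔ γ₂` force `γ₁ ∼_st γ₂`.
[cite: Rogawski1990, §14.1 p. 232] -/
theorem Corresponds.isStablyConj_right {γ' : unitaryGroup σ H'} {γ₁ γ₂ : unitaryGroup σ H}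
    (h₁ : Corresponds σ H' H γ' γ₁) (h₂ : Corresponds σ H' H γ' γ₂) : IsStablyConj σ H γ₁ γ₂ :=
  IsConj.trans h₁.symm h₂

/-- **The correspondence is injective on stable classes**: `γ′₁ ↔ γ` and `γ′₂ ↔ γ` force `γ′₁ ∼_st γ′₂`.
[cite: Rogawski1990, §14.1 p. 232] -/
theorem Corresponds.isStablyConj_left {γ'₁ γ'₂ : unitaryGroup σ H'} {γ : unitaryGroup σ H}
    (h₁ : Corresponds σ H' H γ'₁ γ) (h₂ : Corresponds σ H' H γ'₂ γ) : IsStablyConj σ H' γ'₁ γ'₂ :=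
  IsConj.trans h₁ h₂.symm

/-- Corresponding elements have the same characteristic polynomial. [cite: Rogawski1990, §14.1 p. 232] -/
theorem Corresponds.charpoly_eq {γ' : unitaryGroup σ H'} {γ : unitaryGroup σ H} (h : Corresponds σ H' H γ' γ) :
    ((γ' : GL n R) : Matrix n n R).charpoly = ((γ : GL n R) : Matrix n n R).charpoly := by
  obtain ⟨c, hc⟩ := isConj_iff.mp h
  rw [← hc, Units.val_mul, Units.val_mul, Matrix.coe_units_inv, Matrix.charpoly_units_conj]

/-- Corresponding elements are semisimple together. [cite: Rogawski1990, §14.1 p. 232] -/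
theorem Corresponds.isSemisimpleElt_iff {γ' : unitaryGroup σ H'} {γ : unitaryGroup σ H}
    (h : Corresponds σ H' H γ' γ) : IsSemisimpleElt σ H' γ' ↔ IsSemisimpleElt σ H γ :=
  isSemisimple_toLin'_iff_of_isConj h

/-- **Congruent forms: the correspondence is realised by an isomorphism.**  If `(g.map σ)ᵀ H g = H′` then the tree's
`unitaryGroupCongr σ g H H′ : U(H′) ≃* U(H)`, `x ↦ g x g⁻¹`, maps every `γ′` to an element corresponding to it (so every
stable class of `U(H′)` occurs in `U(H)` and conversely). [cite: Rogawski1990, §14.1 p. 232] -/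
theorem corresponds_unitaryGroupCongr (g : GL n R) (hg : ((g : Matrix n n R).map σ).transpose * H * (g : Matrix n n R) = H')
    (γ' : unitaryGroup σ H') : Corresponds σ H' H γ' (unitaryGroupCongr σ g H H' hg γ') :=
  isConj_iff.mpr ⟨g, by rw [coe_unitaryGroupCongr]⟩

/-- **`𝒪′_st ↔ 𝒪_st` on stable classes** (well defined by `of_isStablyConj_left/right`). [cite: Rogawski1990, §14.1 p. 232] -/
def StableClass.Corresponds : StableClass σ H' → StableClass σ H → Prop :=
  Quotient.lift₂ (Rogawski1990.Corresponds σ H' H) fun _ _ _ _ h' h =>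
    propext ⟨fun hc => (hc.of_isStablyConj_left h').of_isStablyConj_right h,
      fun hc => (hc.of_isStablyConj_left h'.symm).of_isStablyConj_right h.symm⟩

/-- `𝒪_st(γ′) ↔ 𝒪_st(γ)` iff `γ′ ↔ γ`. [cite: Rogawski1990, §14.1 p. 232] -/
@[simp] theorem StableClass.corresponds_stableClassOf {γ' : unitaryGroup σ H'} {γ : unitaryGroup σ H} :
    (stableClassOf σ H' γ').Corresponds (stableClassOf σ H γ) ↔ Rogawski1990.Corresponds σ H' H γ' γ :=
  Iff.rfl

/-- **«We obtain an injective MAP from stable classes in `G′` to … stable classes in `G`»** — functionality: a stable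
class of `U(H′)` corresponds to at most one stable class of `U(H)`. [cite: Rogawski1990, §14.1 p. 232] -/
theorem StableClass.eq_of_corresponds_right {c' : StableClass σ H'} {c₁ c₂ : StableClass σ H}
    (h₁ : c'.Corresponds c₁) (h₂ : c'.Corresponds c₂) : c₁ = c₂ := by
  obtain ⟨γ', rfl⟩ := stableClassOf_surjective c'
  obtain ⟨γ₁, rfl⟩ := stableClassOf_surjective c₁
  obtain ⟨γ₂, rfl⟩ := stableClassOf_surjective c₂
  exact stableClassOf_eq_iff.mpr (Corresponds.isStablyConj_right h₁ h₂)

/-- … and injectivity: two stable classes of `U(H′)` corresponding to the same class of `U(H)` are equal.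
[cite: Rogawski1990, §14.1 p. 232] -/
theorem StableClass.eq_of_corresponds_left {c'₁ c'₂ : StableClass σ H'} {c : StableClass σ H}
    (h₁ : c'₁.Corresponds c) (h₂ : c'₂.Corresponds c) : c'₁ = c'₂ := by
  obtain ⟨γ'₁, rfl⟩ := stableClassOf_surjective c'₁
  obtain ⟨γ'₂, rfl⟩ := stableClassOf_surjective c'₂
  obtain ⟨γ, rfl⟩ := stableClassOf_surjective c
  exact stableClassOf_eq_iff.mpr (Corresponds.isStablyConj_left h₁ h₂)

/-- Corresponding stable classes have the same characteristic polynomial. [cite: Rogawski1990, §14.1 p. 232] -/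
theorem StableClass.charpoly_eq_of_corresponds {c' : StableClass σ H'} {c : StableClass σ H} (h : c'.Corresponds c) :
    c'.charpoly = c.charpoly := by
  obtain ⟨γ', rfl⟩ := stableClassOf_surjective c'
  obtain ⟨γ, rfl⟩ := stableClassOf_surjective c
  exact Corresponds.charpoly_eq h

variable (H') in
/-- **«`γ` occurs in `G′`»**: the stable class `c` of `U(H)(F)` occurs in `U(H′)(F)` if `𝒪′_st ↔ c` for some stable
class `𝒪′_st` of `U(H′)(F)`. [cite: Rogawski1990, §14.1 p. 232] -/
def StableClass.OccursIn (c : StableClass σ H) : Prop :=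
  ∃ c' : StableClass σ H', c'.Corresponds c

/-- `𝒪_st(γ)` occurs in `U(H′)` iff `γ′ ↔ γ` for some `γ′ ∈ U(H′)(F)`. [cite: Rogawski1990, §14.1 p. 232] -/
theorem StableClass.occursIn_stableClassOf_iff {γ : unitaryGroup σ H} :
    (stableClassOf σ H γ).OccursIn H' ↔ ∃ γ' : unitaryGroup σ H', Rogawski1990.Corresponds σ H' H γ' γ := by
  constructor
  · rintro ⟨c', hc'⟩
    obtain ⟨γ', rfl⟩ := stableClassOf_surjective c'
    exact ⟨γ', hc'⟩
  · rintro ⟨γ', h⟩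
    exact ⟨stableClassOf σ H' γ', h⟩

/-- For congruent forms every stable class occurs. [cite: Rogawski1990, §14.1 p. 232] -/
theorem StableClass.occursIn_of_congr (g : GL n R) (hg : ((g : Matrix n n R).map σ).transpose * H' * (g : Matrix n n R) = H)
    (c : StableClass σ H) : c.OccursIn H' := by
  obtain ⟨γ, rfl⟩ := stableClassOf_surjective c
  exact StableClass.occursIn_stableClassOf_iff.mpr
    ⟨unitaryGroupCongr σ g H' H hg γ, corresponds_comm.mp (corresponds_unitaryGroupCongr g hg γ)⟩

/-! ## §3 Letters: the `κ`-orbital sums `Φ^κ(γ, ·)` and the stable orbital sum `Φ^st(γ, ·)` [Rogawski1990, (4.1.1)] -/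

variable (σ H) in
/-- The conjugacy classes of `U(H)(F)` contained in the stable class `𝒪_st(γ)` («the conjugacy classes within
`𝒪_st(γ)`», indexed by `𝔇(G_γ/F)`). [cite: Rogawski1990, §4.1 (4.1.1) p. 39] -/
def conjClassesIn (γ : unitaryGroup σ H) : Set (ConjClasses (unitaryGroup σ H)) :=
  {c | StableClass.ofConjClass c = stableClassOf σ H γ}

/-- `[δ] ⊂ 𝒪_st(γ) ↔ γ ∼_st δ`. [cite: Rogawski1990, §4.1 (4.1.1) p. 39] -/
theorem mk_mem_conjClassesIn_iff {γ δ : unitaryGroup σ H} :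
    ConjClasses.mk δ ∈ conjClassesIn σ H γ ↔ IsStablyConj σ H γ δ := by
  rw [conjClassesIn, Set.mem_setOf_eq, StableClass.ofConjClass_mk, stableClassOf_eq_iff]
  exact ⟨IsStablyConj.symm, IsStablyConj.symm⟩

/-- The class of `γ` itself lies in `𝒪_st(γ)`. [cite: Rogawski1990, §4.1 (4.1.1) p. 39] -/
theorem mk_mem_conjClassesIn_self (γ : unitaryGroup σ H) : ConjClasses.mk γ ∈ conjClassesIn σ H γ :=
  mk_mem_conjClassesIn_iff.mpr (IsStablyConj.refl γ)

/-- `conjClassesIn` depends only on the stable class. [cite: Rogawski1990, §4.1 (4.1.1) p. 39] -/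
theorem conjClassesIn_eq_of_isStablyConj {γ δ : unitaryGroup σ H} (h : IsStablyConj σ H γ δ) :
    conjClassesIn σ H γ = conjClassesIn σ H δ := by
  ext c
  rw [conjClassesIn, conjClassesIn, Set.mem_setOf_eq, Set.mem_setOf_eq, stableClassOf_eq_iff.mpr h]

variable {S : Type*} [CommRing S]

variable (σ H) in
/-- **Letter `Φ^κ(γ, ·)` — the `κ`-orbital sum (4.1.1)**: `Σ_{γ′} κ(inv(γ, γ′)) Φ(γ′)` over the conjugacy classes
`γ′` within `𝒪_st(γ)`, for an INPUT class function `Φ` (the orbital integrals `γ′ ↦ Φ(γ′, f)` of a fixed test function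
`f`) and an INPUT weight `w` (`[γ′] ↦ κ(inv(γ, γ′))`); a `finsum` (zero if infinitely many classes contribute — in the
local setting the index set `𝔇(G_γ/F)` is finite). [cite: Rogawski1990, §4.1 (4.1.1) p. 39] -/
def kappaOrbitalSum (Φ w : ConjClasses (unitaryGroup σ H) → S) (γ : unitaryGroup σ H) : S :=
  ∑ᶠ c ∈ conjClassesIn σ H γ, w c * Φ c

variable (σ H) in
/-- **Letter `Φ^st(γ, ·)` — the stable orbital sum**: `Σ_{γ′} Φ(γ′)` over the conjugacy classes within `𝒪_st(γ)`
(«If `κ` is trivial, `Φ^κ(γ, f)` is called a stable orbital integral and is denoted by `Φ^st(γ, f)`»; for singular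
`γ` the book inserts signs `e(γ′)`, (4.1.2) — not typed). [cite: Rogawski1990, §4.1 (4.1.1) p. 40] -/
def stableOrbitalSum (Φ : ConjClasses (unitaryGroup σ H) → S) (γ : unitaryGroup σ H) : S :=
  ∑ᶠ c ∈ conjClassesIn σ H γ, Φ c

/-- `Φ^st = Φ^κ` for the trivial weight `κ = 1`. [cite: Rogawski1990, §4.1 (4.1.1) p. 40] -/
theorem stableOrbitalSum_eq_kappaOrbitalSum_one (Φ : ConjClasses (unitaryGroup σ H) → S) (γ : unitaryGroup σ H) :
    stableOrbitalSum σ H Φ γ = kappaOrbitalSum σ H Φ 1 γ := by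
  simp only [stableOrbitalSum, kappaOrbitalSum, Pi.one_apply, one_mul]

/-- `Φ^st(γ, ·)` depends only on `𝒪_st(γ)`. [cite: Rogawski1990, §4.1 (4.1.1) p. 40] -/
theorem stableOrbitalSum_eq_of_isStablyConj (Φ : ConjClasses (unitaryGroup σ H) → S) {γ δ : unitaryGroup σ H}
    (h : IsStablyConj σ H γ δ) : stableOrbitalSum σ H Φ γ = stableOrbitalSum σ H Φ δ := by
  rw [stableOrbitalSum, stableOrbitalSum, conjClassesIn_eq_of_isStablyConj h]

/-- `Φ^st` as a function of the stable class: `SΦ(𝒪_st)`. [cite: Rogawski1990, §4.1 (4.1.1) p. 40] -/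
def StableClass.orbitalSum (Φ : ConjClasses (unitaryGroup σ H) → S) : StableClass σ H → S :=
  Quotient.lift (stableOrbitalSum σ H Φ) fun _ _ h => stableOrbitalSum_eq_of_isStablyConj Φ h

/-- `SΦ(𝒪_st(γ)) = Φ^st(γ)`. [cite: Rogawski1990, §4.1 (4.1.1) p. 40] -/
@[simp] theorem StableClass.orbitalSum_stableClassOf (Φ : ConjClasses (unitaryGroup σ H) → S) (γ : unitaryGroup σ H) :
    (stableClassOf σ H γ).orbitalSum Φ = stableOrbitalSum σ H Φ γ := rfl

/-- If `𝒪_st(γ)` is a single conjugacy class («stable conjugacy coincides with conjugacy», e.g. at `v ∈ S ∪ S₀`,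
§14.2) then `Φ^st(γ) = Φ(γ)`. [cite: Rogawski1990, §14.2 p. 232] -/
theorem stableOrbitalSum_eq_of_forall_isConj (Φ : ConjClasses (unitaryGroup σ H) → S) {γ : unitaryGroup σ H}
    (h : ∀ δ, IsStablyConj σ H γ δ → IsConj γ δ) : stableOrbitalSum σ H Φ γ = Φ (ConjClasses.mk γ) := by
  have hs : conjClassesIn σ H γ = {ConjClasses.mk γ} := by
    ext c
    obtain ⟨δ, rfl⟩ := ConjClasses.mk_surjective c
    rw [mk_mem_conjClassesIn_iff, Set.mem_singleton_iff, ConjClasses.mk_eq_mk_iff_isConj]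
    exact ⟨fun h' => (h δ h').symm, fun h' => isStablyConj_of_isConj h'.symm⟩
  rw [stableOrbitalSum, hs, finsum_mem_singleton]

end General

/-! ## §4 Extension of scalars: stable conjugacy vs conjugacy in `GL_n(K)`, `K ⊇ L` (`G(F̄)`-conjugacy) -/

section Field

variable {L : Type*} [CommRing L] {n : Type*} [Fintype n] [DecidableEq n] {σ : L →+* L}
  {H H' : Matrix n n L} (K : Type*) [CommRing K] [Algebra L K]

/-- Stably conjugate elements stay conjugate in `GL_n(K)` for every `L`-algebra `K` (e.g. `K = F̄`): the easy half of
«stably conjugate ⇔ conjugate in `G(F̄) = GL_n(F̄)`». [cite: Rogawski1990, §3.1 p. 19] -/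
theorem IsStablyConj.isConj_map {γ δ : unitaryGroup σ H} (h : IsStablyConj σ H γ δ) :
    IsConj (Matrix.GeneralLinearGroup.map (algebraMap L K) (γ : GL n L))
      (Matrix.GeneralLinearGroup.map (algebraMap L K) (δ : GL n L)) :=
  (Matrix.GeneralLinearGroup.map (algebraMap L K)).map_isConj h

/-- **Rogawski's definition recovered**: `γ, δ ∈ U(H)(F)` are stably conjugate iff their images are conjugate in
`GL_n(K)` for an extension `K ⊇ L`, e.g. an algebraic closure («there exists `g ∈ G(F̄)` such that `δ = g⁻¹γg`»), GIVEN
the descent of similarity from `K` to `L`, `hdesc` = the tree's ★ `Literature.LinearAlgebra.Matrix.isConj_of_isConj_map`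
(`L` an infinite field, `K` a non-trivial commutative `L`-algebra), carried BY NAME as a hypothesis because that module
was unbuilt on the farm snapshot when this file was typed. [cite: Rogawski1990, §3.1 p. 19] -/
theorem isStablyConj_iff_isConj_map_of_descent
    (hdesc : ∀ g h : GL n L, IsConj (Matrix.GeneralLinearGroup.map (algebraMap L K) g)
      (Matrix.GeneralLinearGroup.map (algebraMap L K) h) → IsConj g h)
    (γ δ : unitaryGroup σ H) :
    IsStablyConj σ H γ δ ↔ IsConj (Matrix.GeneralLinearGroup.map (algebraMap L K) (γ : GL n L))
      (Matrix.GeneralLinearGroup.map (algebraMap L K) (δ : GL n L)) :=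
  ⟨fun h => h.isConj_map K, fun h => hdesc _ _ h⟩

end Field

/-! ## §5 (v2 append) The unconditional «iff»: the descent is ★ `isConj_of_isConj_map` -/
section Descent

variable {L : Type*} [Field L] [Infinite L] {n : Type*} [Fintype n] [DecidableEq n] {σ : L →+* L}
  {H H' : Matrix n n L} (K : Type*) [Field K] [Algebra L K]

/-- **Rogawski's definition, unconditionally**: over an infinite field `L`, `γ, δ ∈ U(H)(F)` are stably conjugate iff
their images are conjugate in `GL_n(K)` for any extension field `K ⊇ L`, e.g. in `G(F̄) = GL_n(F̄)` («there exists
`g ∈ G(F̄)` such that `δ = g⁻¹γg`»); descent = ★ `isConj_of_isConj_map`. [cite: Rogawski1990, §3.1 p. 19] -/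
theorem isStablyConj_iff_isConj_map (γ δ : unitaryGroup σ H) :
    IsStablyConj σ H γ δ ↔ IsConj (Matrix.GeneralLinearGroup.map (algebraMap L K) (γ : GL n L))
      (Matrix.GeneralLinearGroup.map (algebraMap L K) (δ : GL n L)) :=
  isStablyConj_iff_isConj_map_of_descent K
    (fun g h hc => Literature.LinearAlgebra.Matrix.isConj_of_isConj_map g h hc) γ δ

/-- `γ′ ↔ γ` iff the images of `γ′, γ` are conjugate in `GL_n(K)`, `K ⊇ L` any field. [cite: Rogawski1990, §14.1 p. 232] -/
theorem corresponds_iff_isConj_map (γ' : unitaryGroup σ H') (γ : unitaryGroup σ H) :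
    Corresponds σ H' H γ' γ ↔ IsConj (Matrix.GeneralLinearGroup.map (algebraMap L K) (γ' : GL n L))
      (Matrix.GeneralLinearGroup.map (algebraMap L K) (γ : GL n L)) :=
  ⟨fun h => (Matrix.GeneralLinearGroup.map (algebraMap L K)).map_isConj h,
    fun h => Literature.LinearAlgebra.Matrix.isConj_of_isConj_map _ _ h⟩

end Descent

end Literature.NumberTheory.Rogawski1990
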